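import Summits.QuantumFields.YangMills.Theorems.F4SubCurvatureDoorSubCurvatureKernelKernelSymmetries
import Summits.QuantumFields.YangMills.Theorems.F4SubCurvatureDoorChamberSorting
import Summits.QuantumFields.YangMills.Theorems.F4SubCurvatureDoorTransverseSliceGeometry
import Mathlib
import HarnessLib

/-!
# Route `F4SubCurvatureDoor`, crux `SubCurvatureKernel` ⟨stmt-QuantumFields-23036⟩ — soft half, input (C) «continuity off 0»,
# part 1: the MOLLIFIED KERNEL (OS matrix coefficients of a radial bump)

Helper file (`--supports stmt-QuantumFields-23036 --as helper`; free-hands seat `ym-line-frs-p2` g18).  Definition-free, 0 sorry,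
standard axioms.  No item is closed; no summit, no crux and no mass gap is proved by this file.

WHAT.  For a measurable kernel `K : ℝ⁴ → ℝ` with the crux's bound `|K u| ≤ A (1 + ‖u‖⁻¹)⁸`, a truncation radius `r > 0`
(`K' := K · 𝟙{r ≤ ‖·‖}`, bounded by `A (1 + r⁻¹)⁸`) and a RADIAL smooth bump `b ≥ 0` of radius `ε`, `∫ b = 1` (`exists_radial_bump`:
`b = φ ∘ ‖·‖²`, so `b ∘ R = b` for EVERY linear isometry `R`), the mollified kernel `κ w := ∫∫ K'(w + θu − v) b(v) b(u)` (`θ` = time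
reflection).  ★ `exists_mollifiedKernel`: `κ` is CONTINUOUS on `ℝ⁴` (the `w`-dependence is moved into the bump by the measure-preserving
map `(v, u) ↦ (v, w + θu − v)`, then dominated convergence), `|κ| ≤ A (1 + r⁻¹)⁸`, `κ(−θw) = κ(w)` EXACTLY as soon as `K(−θu) = K(u)`
a.e. (a.e. symmetries of `K` become exact symmetries of `κ` because `b` is radial), `κ w = ∫∫ K(w + θu − v) b b` when `r + 2ε ≤ |w₀|`,
and the tested form `∫ g κ = ∫∫ b b ∫ g(ξ − θu + v) K'(ξ) dξ` (so `κ → K'` against `C_c` test functions as `ε → 0`);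
`integral_osShift`: `∫∫ K(y₀ − y₁) b(θy₀ − xᵢ) b(y₁ − xⱼ) = ∫∫ K((θxᵢ − xⱼ) + θu − v) b(v) b(u)` (so that
`S₁ 2 (osAdjoint fᵢ ⊗ fⱼ) = cᵢcⱼ κ(θxᵢ − xⱼ)` for the degree-one tuple `fᵢ = cᵢ b(· − xᵢ)`, next file).
WHY (plan of (C), HOME INBOX owner g23 16:54:59Z): `κ` is pointwise OS-positive-definite from ✓`RPPos` (next file), hence has a
Laplace–Fourier measure (✓`exists_laplaceFourierMeasure`); a cluster point of the tilted measures as `ε → 0` represents `K` on a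
half-space by a jointly continuous function; gluing over the four axes gives a version of `K` continuous off `0`.

HONEST LABEL: analytic bookkeeping toward input (C) of the SOFT half of ⟨23036⟩; the SUB-CURVATURE clause (asymptotic freedom) is the
crux, untouched; ⟨23036⟩ is an open problem; the Yang–Mills mass gap is NOT proved; no summit is proved by a line.
-/

set_option autoImplicit false

noncomputable section

open scoped BigOperators ContDiff Topology
open MeasureTheory Filter Set Metric Function
open Literature.MathematicalPhysics.QuantumLattice (timeReflection timeReflection_apply timeReflection_timeReflection)
open Summit.QuantumFields.YangMills.Cruxes.OSLegsAtWeakCouplingC.Sketch (IsSignedPerm)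
open Summit.QuantumFields.YangMills.Theorems.NPointIsotropy.Negative (E4)
open Summit.QuantumFields.YangMills.Theorems.F4SubCurvatureDoorSliceInClass (isSignedPerm_timeReflection)

namespace Summit.QuantumFields.YangMills.Theorems.F4SubCurvatureDoorSubCurvatureKernelMollifier

/-! ## §1 The spatial inversion is a signed permutation -/

/-- `−θ` (the spatial inversion `(x₀, x⃗) ↦ (x₀, −x⃗)`) as a linear isometric equivalence is a signed permutation. [folklore] -/
theorem isSignedPerm_timeReflection_trans_neg :
    IsSignedPerm ((timeReflection 4).trans (LinearIsometryEquiv.neg ℝ)) :=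
  F4SubCurvatureDoorGlobalReduction.isSignedPerm_trans isSignedPerm_timeReflection
    F4SubCurvatureDoorGlobalReduction.isSignedPerm_neg

/-- `((θ).trans neg) u = -(θ u)`. [bookkeeping] -/
theorem timeReflection_trans_neg_apply (u : E4) :
    ((timeReflection 4).trans (LinearIsometryEquiv.neg ℝ)) u = -(timeReflection 4 u) := rfl

/-! ## §2 A radial smooth bump of radius `ε` -/

/-- **A radial smooth bump**: for `ε > 0` there is `b : ℝ⁴ → ℝ`, smooth, compactly supported in the open ball of radius `ε`,
`b ≥ 0`, `∫ b = 1`, invariant under EVERY linear isometry (it is a function of `‖u‖²`). [folklore] -/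
theorem exists_radial_bump {ε : ℝ} (hε : 0 < ε) :
    ∃ b : E4 → ℝ, ContDiff ℝ ∞ b ∧ HasCompactSupport b ∧ (∀ u, 0 ≤ b u) ∧ (∫ u, b u = 1) ∧
      (∀ u, b u ≠ 0 → ‖u‖ < ε) ∧ ∀ (R : E4 ≃ₗᵢ[ℝ] E4) (u : E4), b (R u) = b u := by
  let φ : ContDiffBump (0 : ℝ) := ⟨ε ^ 2 / 4, ε ^ 2 / 2, by positivity, by nlinarith⟩
  set b₁ : E4 → ℝ := fun u => φ (‖u‖ ^ 2) with hb₁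
  have hb₁s : ContDiff ℝ ∞ b₁ := φ.contDiff.comp (contDiff_norm_sq ℝ)
  have hb₁supp : ∀ u, b₁ u ≠ 0 → ‖u‖ < ε := by
    intro u hu
    have h : ‖u‖ ^ 2 ∈ Function.support (φ : ℝ → ℝ) := hu
    rw [φ.support_eq, Metric.mem_ball, dist_zero_right, Real.norm_eq_abs, abs_of_nonneg (by positivity)] at h
    have h' : ‖u‖ ^ 2 < ε ^ 2 := by
      have : ε ^ 2 / 2 < ε ^ 2 := by nlinarith
      exact h.trans this
    exact lt_of_pow_lt_pow_left₀ 2 hε.le h'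
  have hb₁c : HasCompactSupport b₁ := by
    refine HasCompactSupport.intro (isCompact_closedBall (0 : E4) ε) fun u hu => ?_
    by_contra h
    exact hu (mem_closedBall_zero_iff.2 (hb₁supp u h).le)
  have hb₁0 : ∀ u, 0 ≤ b₁ u := fun u => φ.nonneg
  have hb₁zero : b₁ 0 = 1 := by
    simp only [hb₁, norm_zero]
    rw [zero_pow two_ne_zero]
    exact φ.one_of_mem_closedBall (by simp [φ]; positivity)
  have hI : 0 < ∫ u, b₁ u :=
    hb₁s.continuous.integral_pos_of_hasCompactSupport_nonneg_nonzero hb₁c hb₁0 (x := 0) (by rw [hb₁zero]; norm_num)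
  set c : ℝ := ∫ u, b₁ u with hc
  have hbc : HasCompactSupport fun u => b₁ u / c := by
    have h := hb₁c.mul_right (f' := fun _ : E4 => c⁻¹)
    simp_rw [div_eq_mul_inv]
    exact h
  refine ⟨fun u => b₁ u / c, hb₁s.div_const c, hbc, fun u => div_nonneg (hb₁0 u) hI.le, ?_, fun u hu => ?_,
    fun R u => ?_⟩
  · rw [integral_div, hc, div_self hI.ne']
  · exact hb₁supp u (by intro h; apply hu; simp [h])
  · simp only [hb₁, LinearIsometryEquiv.norm_map]


/-! ## §3 The OS change of variables -/

/-- **The OS change of variables** `(y₀, y₁) ↦ (y₁ − xⱼ, θy₀ − xᵢ)` (measure preserving on `ℝ⁴ × ℝ⁴`):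
`∫∫ K(y₀ − y₁) b(θy₀ − xᵢ) b(y₁ − xⱼ) = ∫∫ K((θxᵢ − xⱼ) + θu − v) b(v) b(u)`.  No hypothesis on `K`, `b`. [folklore] -/
theorem integral_osShift (K b : E4 → ℝ) (xi xj : E4) :
    ∫ y : E4 × E4, K (y.1 - y.2) * (b (timeReflection 4 y.1 - xi) * b (y.2 - xj)) =
      ∫ p : E4 × E4, K ((timeReflection 4 xi - xj) + timeReflection 4 p.2 - p.1) * (b p.1 * b p.2) := by
  set θ := timeReflection 4 with hθ
  -- the measurable equivalence `y ↦ (y.2 - xj, θ y.1 - xi)`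
  set e : E4 × E4 ≃ᵐ E4 × E4 :=
    MeasurableEquiv.prodComm.trans
      (MeasurableEquiv.prodCongr (MeasurableEquiv.subRight xj) (θ.toMeasurableEquiv.trans (MeasurableEquiv.subRight xi)))
    with he
  have he_apply : ∀ y : E4 × E4, e y = (y.2 - xj, θ y.1 - xi) := fun y => rfl
  have hme : MeasurePreserving e := by
    have h1 : MeasurePreserving (MeasurableEquiv.subRight xj : E4 ≃ᵐ E4) := measurePreserving_sub_right volume xj
    have h2 : MeasurePreserving (θ.toMeasurableEquiv.trans (MeasurableEquiv.subRight xi) : E4 ≃ᵐ E4) :=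
      (measurePreserving_sub_right volume xi).comp θ.measurePreserving
    have h3 : MeasurePreserving (MeasurableEquiv.prodComm : E4 × E4 ≃ᵐ E4 × E4) :=
      (Measure.measurePreserving_swap (μ := (volume : Measure E4)) (ν := (volume : Measure E4)))
    exact (h1.prod h2).comp h3
  have key := hme.integral_comp' (fun p : E4 × E4 => K ((θ xi - xj) + θ p.2 - p.1) * (b p.1 * b p.2))
  rw [← key]
  refine integral_congr_ae (Eventually.of_forall fun y => ?_)
  simp only [he_apply]
  have harg : θ xi - xj + θ (θ y.1 - xi) - (y.2 - xj) = y.1 - y.2 := by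
    rw [map_sub, hθ, timeReflection_timeReflection]; abel
  rw [harg, mul_comm (b (y.2 - xj))]

/-! ## §4 The mollified kernel -/

/-- ★ **THE MOLLIFIED KERNEL** of a measurable `K` with the crux's bound, at truncation radius `r` and bump radius `ε`:
`κ w = ∫∫ K'(w + θu − v) b(v) b(u)` with `K' = K · 𝟙{r ≤ ‖·‖}` and `b` a radial bump — continuous, bounded by `A (1 + r⁻¹)⁸`,
exactly invariant under the spatial inversion `−θ` when `K` is a.e., equal to `∫∫ K(w + θu − v) b b` for `r + 2ε ≤ |w₀|`, with the
tested form `∫ g κ = ∫∫ b b ∫ g(ξ − θu + v) K'(ξ) dξ`. [folklore] -/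
theorem exists_mollifiedKernel (K : E4 → ℝ) (hKm : Measurable K) {A : ℝ}
    (hKb : ∀ u, |K u| ≤ A * (1 + ‖u‖⁻¹) ^ 8)
    (hKP : ∀ᵐ u : E4, K (-(timeReflection 4 u)) = K u) {r ε : ℝ} (hr : 0 < r) (hε : 0 < ε) :
    ∃ (b κ : E4 → ℝ),
      ContDiff ℝ ∞ b ∧ HasCompactSupport b ∧ (∀ u, 0 ≤ b u) ∧ (∫ u, b u = 1) ∧ (∀ u, b u ≠ 0 → ‖u‖ < ε) ∧
      (∀ (R : E4 ≃ₗᵢ[ℝ] E4) (u : E4), b (R u) = b u) ∧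
      Continuous κ ∧ (∀ w, |κ w| ≤ A * (1 + r⁻¹) ^ 8) ∧ (∀ w, κ (-(timeReflection 4 w)) = κ w) ∧
      (∀ w : E4, r + 2 * ε ≤ |w 0| →
        κ w = ∫ p : E4 × E4, K (w + timeReflection 4 p.2 - p.1) * (b p.1 * b p.2)) ∧
      (∀ g : E4 → ℝ, Continuous g → HasCompactSupport g →
        ∫ w, g w * κ w = ∫ p : E4 × E4, (b p.1 * b p.2) *
          ∫ ξ, g (ξ - timeReflection 4 p.2 + p.1) * (if r ≤ ‖ξ‖ then K ξ else 0)) := by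
  set θ := timeReflection 4 with hθ
  -- the constant and the truncated kernel
  have hA : 0 ≤ A := by
    have h1 := hKb 0; have h2 : (1 + ‖(0 : E4)‖⁻¹) ^ 8 = 1 := by simp
    rw [h2, mul_one] at h1; exact (abs_nonneg _).trans h1
  set B : ℝ := A * (1 + r⁻¹) ^ 8 with hB
  have hB0 : 0 ≤ B := by positivity
  set K' : E4 → ℝ := fun ξ => if r ≤ ‖ξ‖ then K ξ else 0 with hK'
  have hK'm : Measurable K' := Measurable.ite (measurableSet_le measurable_const measurable_norm) hKm measurable_const
  have hK'b : ∀ ξ, |K' ξ| ≤ B := by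
    intro ξ
    simp only [hK']
    split_ifs with h
    · refine (hKb ξ).trans (mul_le_mul_of_nonneg_left ?_ hA)
      have hξ : 0 < ‖ξ‖ := hr.trans_le h
      have : ‖ξ‖⁻¹ ≤ r⁻¹ := by rw [inv_le_inv₀ hξ hr]; exact h
      exact pow_le_pow_left₀ (by positivity) (by linarith) 8
    · rw [abs_zero]; exact hB0
  have hK'P : ∀ᵐ ξ : E4, K' (-(θ ξ)) = K' ξ := by
    filter_upwards [hKP] with ξ hξ
    simp only [hK', norm_neg, LinearIsometryEquiv.norm_map, hξ]
  -- the bump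
  obtain ⟨b, hbs, hbc, hb0, hb1, hbsupp, hbR⟩ := exists_radial_bump hε
  have hbcont : Continuous b := hbs.continuous
  have hbm : Measurable b := hbcont.measurable
  have hbi : Integrable b := hbcont.integrable_of_hasCompactSupport hbc
  obtain ⟨M, hM⟩ := hbcont.bounded_above_of_compact_support hbc
  have hM0 : 0 ≤ M := (norm_nonneg _).trans (hM 0)
  have hbθ : ∀ u, b (θ u) = b u := fun u => hbR θ u
  have hbb : Integrable (fun p : E4 × E4 => b p.1 * b p.2) := by have := hbi.mul_prod hbi; exact this
  have hbb_int : ∫ p : E4 × E4, b p.1 * b p.2 = 1 := by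
    rw [show (volume : Measure (E4 × E4)) = volume.prod volume from rfl, integral_prod_mul, hb1, mul_one]
  -- the mollified kernel
  set κ : E4 → ℝ := fun w => ∫ p : E4 × E4, K' (w + θ p.2 - p.1) * (b p.1 * b p.2) with hκ
  -- measurability of the integrand (jointly in `(w, p)`)
  have hlin : Continuous fun q : E4 × (E4 × E4) => q.1 + θ q.2.2 - q.2.1 := by fun_prop
  have hF_meas : ∀ w, AEStronglyMeasurable (fun p : E4 × E4 => K' (w + θ p.2 - p.1) * (b p.1 * b p.2)) := by
    intro w
    have hmeas : Measurable fun p : E4 × E4 => w + θ p.2 - p.1 := by fun_prop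
    exact ((hK'm.comp hmeas).mul ((hbm.comp measurable_fst).mul (hbm.comp measurable_snd))).aestronglyMeasurable
  -- pointwise bound of the integrand
  have hF_bd : ∀ w (p : E4 × E4), ‖K' (w + θ p.2 - p.1) * (b p.1 * b p.2)‖ ≤ B * (b p.1 * b p.2) := by
    intro w p
    rw [Real.norm_eq_abs, abs_mul, abs_of_nonneg (mul_nonneg (hb0 _) (hb0 _))]
    exact mul_le_mul_of_nonneg_right (hK'b _) (mul_nonneg (hb0 _) (hb0 _))
  -- (C2) the bound
  have hC2 : ∀ w, |κ w| ≤ B := by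
    intro w
    have h := norm_integral_le_of_norm_le (hbb.const_mul B) (Eventually.of_forall (hF_bd w))
    rw [integral_const_mul, hbb_int, mul_one] at h
    simpa [Real.norm_eq_abs] using h
  -- (C1) continuity: move the `w`-dependence into the bump
  have hmoved : ∀ w, κ w = ∫ q : E4 × E4, K' q.2 * (b q.1 * b (q.2 - w + q.1)) := by
    intro w
    -- the measurable equivalence `(v, u) ↦ (v, w + θ u - v)`
    let e : E4 × E4 ≃ᵐ E4 × E4 :=
      { toFun := fun p => (p.1, w + θ p.2 - p.1)
        invFun := fun q => (q.1, θ (q.2 - w + q.1))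
        left_inv := fun p => by
          show (p.1, θ (w + θ p.2 - p.1 - w + p.1)) = p
          have : w + θ p.2 - p.1 - w + p.1 = θ p.2 := by abel
          rw [this, hθ, timeReflection_timeReflection]
        right_inv := fun q => by
          show (q.1, w + θ (θ (q.2 - w + q.1)) - q.1) = q
          rw [hθ, timeReflection_timeReflection]
          ext1 <;> simp only; abel
        measurable_toFun := by
          show Measurable fun p : E4 × E4 => (p.1, w + θ p.2 - p.1)
          fun_prop
        measurable_invFun := by
          show Measurable fun q : E4 × E4 => (q.1, θ (q.2 - w + q.1))
          fun_prop }
    have he : MeasurePreserving e := by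
      refine MeasurePreserving.skew_product (f := id) (g := fun (a : E4) (c : E4) => w + θ c - a)
        (MeasurePreserving.id volume) (by fun_prop) (Eventually.of_forall fun a => ?_)
      have h : MeasurePreserving (fun c : E4 => θ c + (w - a)) volume volume :=
        (measurePreserving_add_right volume (w - a)).comp θ.measurePreserving
      have hfun : (fun c : E4 => w + θ c - a) = fun c => θ c + (w - a) := by funext c; abel
      rw [hfun]; exact h.map_eq
    have key := he.integral_comp' (fun q : E4 × E4 => K' q.2 * (b q.1 * b (θ (q.2 - w + q.1))))
    simp only [hκ]
    rw [show (fun q : E4 × E4 => K' q.2 * (b q.1 * b (q.2 - w + q.1))) =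
        fun q : E4 × E4 => K' q.2 * (b q.1 * b (θ (q.2 - w + q.1))) from funext fun q => by rw [hbθ]]
    rw [← key]
    refine integral_congr_ae (Eventually.of_forall fun p => ?_)
    show K' (w + θ p.2 - p.1) * (b p.1 * b p.2) = K' (w + θ p.2 - p.1) * (b p.1 * b (θ (w + θ p.2 - p.1 - w + p.1)))
    have : w + θ p.2 - p.1 - w + p.1 = θ p.2 := by abel
    rw [this, hθ, timeReflection_timeReflection]
  have hC1 : Continuous κ := by
    rw [show κ = fun w => ∫ q : E4 × E4, K' q.2 * (b q.1 * b (q.2 - w + q.1)) from funext hmoved]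
    refine continuous_iff_continuousAt.2 fun w₀ => ?_
    set R : ℝ := ‖w₀‖ + 1 + 2 * ε with hR
    set bound : E4 × E4 → ℝ := fun q => (B * M) * (b q.1 * (closedBall (0 : E4) R).indicator (fun _ => (1 : ℝ)) q.2)
      with hbound
    refine continuousAt_of_dominated (bound := bound) (Eventually.of_forall fun w => ?_) ?_ ?_
      (Eventually.of_forall fun q => ?_)
    · refine (Measurable.mul (hK'm.comp measurable_snd)
        ((hbm.comp measurable_fst).mul (hbm.comp ?_))).aestronglyMeasurable
      fun_prop
    · have hnear : ∀ᶠ w in 𝓝 w₀, ‖w - w₀‖ < 1 := by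
        have := Metric.ball_mem_nhds w₀ one_pos
        filter_upwards [this] with w hw
        rwa [mem_ball, dist_eq_norm] at hw
      filter_upwards [hnear] with w hw
      refine Eventually.of_forall fun q => ?_
      simp only [hbound]
      by_cases h1 : b q.1 = 0
      · simp [h1]
      by_cases h2 : b (q.2 - w + q.1) = 0
      · rw [h2, mul_zero, mul_zero, norm_zero]
        exact mul_nonneg (mul_nonneg hB0 hM0) (mul_nonneg (hb0 _) (Set.indicator_nonneg (fun _ _ => zero_le_one) _))
      have hq1 : ‖q.1‖ < ε := hbsupp _ h1
      have hq2 : ‖q.2 - w + q.1‖ < ε := hbsupp _ h2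
      have hmem : q.2 ∈ closedBall (0 : E4) R := by
        rw [mem_closedBall, dist_zero_right]
        have e1 : q.2 = (q.2 - w + q.1) + (w - w₀) + w₀ - q.1 := by abel
        have : ‖q.2‖ ≤ ‖q.2 - w + q.1‖ + ‖w - w₀‖ + ‖w₀‖ + ‖q.1‖ := by
          calc ‖q.2‖ = ‖(q.2 - w + q.1) + (w - w₀) + w₀ - q.1‖ := by rw [← e1]
            _ ≤ ‖(q.2 - w + q.1) + (w - w₀) + w₀‖ + ‖q.1‖ := norm_sub_le _ _
            _ ≤ ‖(q.2 - w + q.1) + (w - w₀)‖ + ‖w₀‖ + ‖q.1‖ := by gcongr; exact norm_add_le _ _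
            _ ≤ ‖q.2 - w + q.1‖ + ‖w - w₀‖ + ‖w₀‖ + ‖q.1‖ := by gcongr; exact norm_add_le _ _
        rw [hR]; linarith
      rw [Set.indicator_of_mem hmem, mul_one, Real.norm_eq_abs, abs_mul, abs_mul, abs_of_nonneg (hb0 _),
        abs_of_nonneg (hb0 _)]
      have e2 : |K' q.2| * (b q.1 * b (q.2 - w + q.1)) ≤ B * (b q.1 * M) := by
        refine mul_le_mul (hK'b _) (mul_le_mul_of_nonneg_left ?_ (hb0 _)) (mul_nonneg (hb0 _) (hb0 _)) hB0
        exact (le_abs_self _).trans ((Real.norm_eq_abs _).symm.le.trans (hM _))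
      linarith
    · simp only [hbound]
      refine Integrable.const_mul ?_ _
      have hind : Integrable ((closedBall (0 : E4) R).indicator (fun _ => (1 : ℝ))) :=
        (integrable_indicator_iff measurableSet_closedBall).2
          (integrableOn_const (isCompact_closedBall (0 : E4) R).measure_lt_top.ne)
      have := hbi.mul_prod hind; exact this
    · exact ((continuous_const.mul ((continuous_const.mul
        (hbcont.comp (by fun_prop : Continuous fun w : E4 => q.2 - w + q.1)))))).continuousAt
  -- (C3) exact invariance under the spatial inversion `-θ`
  have hC3 : ∀ w, κ (-(θ w)) = κ w := by
    intro w
    -- the map `p ↦ w - p.2 + θ p.1` is quasi measure preserving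
    have hqmp : Measure.QuasiMeasurePreserving (fun p : E4 × E4 => w - p.2 + θ p.1)
        (volume : Measure (E4 × E4)) volume := by
      have h1 : MeasurePreserving (fun p : E4 × E4 => (θ p.1 + w, p.2)) (volume.prod volume) (volume.prod volume) :=
        ((measurePreserving_add_right volume w).comp θ.measurePreserving).prod (MeasurePreserving.id volume)
      have h2 : Measure.QuasiMeasurePreserving (fun q : E4 × E4 => q.1 - q.2) (volume.prod volume) volume :=
        quasiMeasurePreserving_sub_of_right_invariant volume volume
      have h3 := h2.comp h1.quasiMeasurePreserving
      have hfun : (fun p : E4 × E4 => w - p.2 + θ p.1) = (fun q : E4 × E4 => q.1 - q.2) ∘ fun p : E4 × E4 => (θ p.1 + w, p.2) := by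
        funext p; simp only [Function.comp_apply]; abel
      rw [hfun]; exact h3
    have hae : (fun p : E4 × E4 => K' (-(θ (w - p.2 + θ p.1))) * (b p.1 * b p.2)) =ᵐ[volume]
        fun p : E4 × E4 => K' (w - p.2 + θ p.1) * (b p.1 * b p.2) := by
      have h := hqmp.ae_eq_comp (g := fun ξ => K' (-(θ ξ))) (g' := K') hK'P
      filter_upwards [h] with p hp
      simp only [Function.comp_apply] at hp
      rw [hp]
    calc κ (-(θ w)) = ∫ p : E4 × E4, K' (-(θ (w - p.2 + θ p.1))) * (b p.1 * b p.2) := by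
          simp only [hκ]
          refine integral_congr_ae (Eventually.of_forall fun p => ?_)
          beta_reduce
          have : -θ w + θ p.2 - p.1 = -(θ (w - p.2 + θ p.1)) := by
            rw [map_add, map_sub, hθ, timeReflection_timeReflection]; abel
          rw [this]
      _ = ∫ p : E4 × E4, K' (w - p.2 + θ p.1) * (b p.1 * b p.2) := integral_congr_ae hae
      _ = ∫ p : E4 × E4, K' (w + θ p.2 - p.1) * (b p.1 * b p.2) := by
          have hsw := (Measure.measurePreserving_swap (μ := (volume : Measure E4)) (ν := (volume : Measure E4))).integral_comp'
            (f := MeasurableEquiv.prodComm) (fun p : E4 × E4 => K' (w + θ p.2 - p.1) * (b p.1 * b p.2))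
          rw [show (volume : Measure (E4 × E4)) = volume.prod volume from rfl, ← hsw]
          refine integral_congr_ae (Eventually.of_forall fun p => ?_)
          show K' (w - p.2 + θ p.1) * (b p.1 * b p.2) = K' (w + θ p.1 - p.2) * (b p.2 * b p.1)
          rw [mul_comm (b p.2), show w - p.2 + θ p.1 = w + θ p.1 - p.2 by abel]
      _ = κ w := rfl
  -- (C4) the truncation is invisible when `r + 2ε ≤ |w₀|`
  have hC4 : ∀ w : E4, r + 2 * ε ≤ |w 0| → κ w = ∫ p : E4 × E4, K (w + θ p.2 - p.1) * (b p.1 * b p.2) := by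
    intro w hw
    simp only [hκ]
    refine integral_congr_ae (Eventually.of_forall fun p => ?_)
    by_cases h1 : b p.1 = 0; · simp [h1]
    by_cases h2 : b p.2 = 0; · simp [h2]
    have hp1 : ‖p.1‖ < ε := hbsupp _ h1
    have hp2 : ‖p.2‖ < ε := hbsupp _ h2
    have hξ : r ≤ ‖w + θ p.2 - p.1‖ := by
      have e0 : (w + θ p.2 - p.1) 0 = w 0 - p.2 0 - p.1 0 := by
        rw [PiLp.sub_apply, PiLp.add_apply, hθ, timeReflection_apply, if_pos rfl]; ring
      have e1 : |p.1 0| ≤ ‖p.1‖ := by simpa [Real.norm_eq_abs] using PiLp.norm_apply_le (p := 2) p.1 0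
      have e2 : |p.2 0| ≤ ‖p.2‖ := by simpa [Real.norm_eq_abs] using PiLp.norm_apply_le (p := 2) p.2 0
      have e3 : |(w + θ p.2 - p.1) 0| ≤ ‖w + θ p.2 - p.1‖ := by
        simpa [Real.norm_eq_abs] using PiLp.norm_apply_le (p := 2) (w + θ p.2 - p.1) 0
      have e4 := abs_sub_abs_le_abs_sub (w 0 - p.2 0) (p.1 0)
      have e5 := abs_sub_abs_le_abs_sub (w 0) (p.2 0)
      rw [e0] at e3; linarith
    simp only [hK', if_pos hξ]
  -- (C5) the tested form
  have hC5 : ∀ g : E4 → ℝ, Continuous g → HasCompactSupport g →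
      ∫ w, g w * κ w = ∫ p : E4 × E4, (b p.1 * b p.2) * ∫ ξ, g (ξ - θ p.2 + p.1) * K' ξ := by
    intro g hg hgc
    have hgi : Integrable g := hg.integrable_of_hasCompactSupport hgc
    -- joint integrability
    have hI : Integrable (uncurry fun (w : E4) (p : E4 × E4) => g w * (K' (w + θ p.2 - p.1) * (b p.1 * b p.2)))
        ((volume : Measure E4).prod volume) := by
      have hdom : Integrable (fun q : E4 × (E4 × E4) => ‖g q.1‖ * (B * (b q.2.1 * b q.2.2))) ((volume : Measure E4).prod volume) := by
        have := hgi.norm.mul_prod (hbb.const_mul B); exact this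
      refine hdom.mono' ?_ (Eventually.of_forall fun q => ?_)
      · refine ((hg.measurable.comp measurable_fst).mul ((hK'm.comp hlin.measurable).mul
          ((hbm.comp (measurable_fst.comp measurable_snd)).mul (hbm.comp (measurable_snd.comp measurable_snd))))).aestronglyMeasurable
      · simp only [uncurry]
        rw [norm_mul]
        refine mul_le_mul_of_nonneg_left (hF_bd q.1 q.2) (norm_nonneg _)
    calc ∫ w, g w * κ w = ∫ w, ∫ p : E4 × E4, g w * (K' (w + θ p.2 - p.1) * (b p.1 * b p.2)) := by
          refine integral_congr_ae (Eventually.of_forall fun w => ?_)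
          simp only [hκ]
          rw [integral_const_mul]
      _ = ∫ p : E4 × E4, ∫ w, g w * (K' (w + θ p.2 - p.1) * (b p.1 * b p.2)) := integral_integral_swap hI
      _ = ∫ p : E4 × E4, (b p.1 * b p.2) * ∫ ξ, g (ξ - θ p.2 + p.1) * K' ξ := by
          refine integral_congr_ae (Eventually.of_forall fun p => ?_)
          have h1 : ∫ w, g w * (K' (w + θ p.2 - p.1) * (b p.1 * b p.2)) =
              (b p.1 * b p.2) * ∫ w, g w * K' (w + (θ p.2 - p.1)) := by
            rw [← integral_const_mul]
            refine integral_congr_ae (Eventually.of_forall fun w => ?_)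
            beta_reduce
            rw [add_sub_assoc]; ring
          have h2 : ∫ w, g w * K' (w + (θ p.2 - p.1)) = ∫ ξ, g (ξ - θ p.2 + p.1) * K' ξ := by
            have := integral_add_right_eq_self (μ := (volume : Measure E4))
              (fun ξ => g (ξ - θ p.2 + p.1) * K' ξ) (θ p.2 - p.1)
            rw [← this]
            refine integral_congr_ae (Eventually.of_forall fun w => ?_)
            beta_reduce
            rw [show w + (θ p.2 - p.1) - θ p.2 + p.1 = w by abel]
          beta_reduce
          rw [h1, h2]
  exact ⟨b, κ, hbs, hbc, hb0, hb1, hbsupp, hbR, hC1, hC2, hC3, hC4, hC5⟩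

end Summit.QuantumFields.YangMills.Theorems.F4SubCurvatureDoorSubCurvatureKernelMollifier

end
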